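import Mathlib
import Summits.NavierStokesRegularity.NavierStokesRegularity.Theorems.FilamentSkeletonRssSkeletonEquilibriumLengthRegularRadial

/-!
# OUTER length-regularity of equilibrium filaments, and full length-regularity of slow ones
(helper for the registered stub `stub_lengthRegular` of crux `FilamentSkeletonRss.SkeletonEquilibrium`,
stmt-NavierStokesRegularity-15400; builds on the radial monotonicity of `…LengthRegularRadial`)

Setting as in `…LengthRegularRadial`: a unit-speed proper filament `Ξ` with
`u(τ) + ½ Ξ(τ) − α e₃ × Ξ(τ) = w(τ) Ξ′(τ)` and `‖u(τ)‖ ≤ U` along it (no stagnation clause).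

Results (sorry-free):
* `volume_inter_le_of_growth`, `volume_ball_outer_le` — the parameter length of the filament inside ANY ball
  `B(x, D)` and outside the velocity ball `‖Ξ‖ ≤ 4U` is `≤ 4(3 + 4|α|)·D` (two monotone branches, each crossing
  the shell `‖x‖ − D ≤ ‖y‖ ≤ ‖x‖ + D` once at radial speed `≥ (3 + 4|α|)⁻¹`);
* `volume_ball_le_inner_add` — `volume {τ | ‖Ξ τ − x‖ ≤ D} ≤ volume(… ∩ {‖Ξ‖ ≤ 4U}) + 4(3 + 4|α|)·D`:
  length-regularity of an equilibrium filament REDUCES to a no-coiling bound inside its velocity ball;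
* `inner_interval_length_le` — with a curvature bound `‖Ξ″‖ ≤ κ₀` and `8Uκ₀ ≤ 1` the inner interval has
  parameter length `≤ 16U` (convexity of `‖Ξ‖²` there), whence `volume_ball_le_of_slow`
  (`≤ 16U + 4(3 + 4|α|)·D` for every ball) and, in the stub's units (`‖Ξ″‖√Γ ≤ K`, `D ≥ √Γ`),
  `lengthRegular_of_slow`: `8·U·K ≤ √Γ ⇒ volume {τ | ‖Ξ τ − x‖ ≤ D} ≤ (4(3 + 4|α|) + 2/K)·D`.

What this isolates for `stub_lengthRegular` (which stays OPEN): the stub holds for every witness whose induced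
velocity along its filaments obeys `8·U·K ≤ √Γ` ("slow" witnesses); in general the two missing inputs are
exactly (i) an a-priori sup bound `U` on the skeleton velocity along the filaments and (ii) a no-coiling estimate
inside the velocity ball `‖Ξ‖ ≤ 4U` when `4U ≫ √Γ/K` (the LIA scale is `U ~ K√Γ log Γ`). No summit statement
is proved; NS regularity is not touched.
-/

noncomputable section

open Set Filter Topology MeasureTheory
open Literature.Analysis.FluidPDE Literature.Analysis.FluidPDE.Tao2016
open scoped RealInnerProductSpace InnerProductSpace

namespace Summit.NavierStokesRegularity.NavierStokesRegularity.Theorems.SkeletonEquilibrium.LengthRegular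
set_option linter.dupNamespace false

/-! ## Length bounds -/

/-- Measure from growth: if on a set `A` the radial function is `(3 + 4|α|)⁻¹`-expanding in the
parameter, `(3 + 4|α|)⁻¹ |τ₂ − τ₁| ≤ |‖Ξ τ₂‖ − ‖Ξ τ₁‖|`, then the parameters in `A` at which the filament
lies in the ball `B(x, D)` form a set of Lebesgue measure `≤ 2(3 + 4|α|)·D` (its diameter: the radii
`‖Ξ τ‖` all lie in `[‖x‖ − D, ‖x‖ + D]`). [folklore] -/
theorem volume_inter_le_of_growth {Ξ : ℝ → EuclideanSpace ℝ (Fin 3)} {α : ℝ} {A : Set ℝ}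
    (hgrow : ∀ τ₁ ∈ A, ∀ τ₂ ∈ A, (3 + 4 * |α|)⁻¹ * |τ₂ - τ₁| ≤ |‖Ξ τ₂‖ - ‖Ξ τ₁‖|)
    (x : EuclideanSpace ℝ (Fin 3)) (D : ℝ) :
    volume ({τ | ‖Ξ τ - x‖ ≤ D} ∩ A) ≤ ENNReal.ofReal (2 * (3 + 4 * |α|) * D) := by
  refine le_trans (Real.volume_le_diam _) (Metric.ediam_le ?_)
  intro τ₁ hτ₁ τ₂ hτ₂
  rw [edist_dist, Real.dist_eq]
  apply ENNReal.ofReal_le_ofReal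
  have hc : 0 < 3 + 4 * |α| := by positivity
  have h1 : |‖Ξ τ₁‖ - ‖x‖| ≤ D := le_trans (abs_norm_sub_norm_le _ _) hτ₁.1
  have h2 : |‖Ξ τ₂‖ - ‖x‖| ≤ D := le_trans (abs_norm_sub_norm_le _ _) hτ₂.1
  have h3 : |‖Ξ τ₁‖ - ‖Ξ τ₂‖| ≤ 2 * D := by
    rw [abs_le] at h1 h2 ⊢; constructor <;> linarith [h1.1, h1.2, h2.1, h2.2]
  have h4 := hgrow τ₂ hτ₂.2 τ₁ hτ₁.2
  have h5 : (3 + 4 * |α|)⁻¹ * |τ₁ - τ₂| ≤ 2 * D := le_trans h4 h3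
  rw [inv_mul_le_iff₀ hc] at h5
  linarith

/-- **Outer length-regularity.** For a unit-speed proper filament of a relative equilibrium with induced
velocity `‖u‖ ≤ U` along it, and ANY ball `B(x, D)`: the parameters at which the filament lies in the
ball but outside the velocity ball `‖Ξ‖ ≤ 4U` have Lebesgue measure `≤ 4(3 + 4|α|)·D` — two monotone
branches, each crossing the shell `‖x‖ − D ≤ ‖y‖ ≤ ‖x‖ + D` once at radial speed `≥ (3+4|α|)⁻¹`.
[folklore] -/
theorem volume_ball_outer_le {Ξ u : ℝ → EuclideanSpace ℝ (Fin 3)} {w : ℝ → ℝ} {α U : ℝ}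
    (hΞ : Differentiable ℝ Ξ) (hT : ∀ τ, ‖deriv Ξ τ‖ = 1)
    (heq : ∀ τ, u τ + (1 / 2 : ℝ) • Ξ τ - α • cross (EuclideanSpace.single (2 : Fin 3) (1 : ℝ)) (Ξ τ)
      = w τ • deriv Ξ τ)
    (hu : ∀ τ, ‖u τ‖ ≤ U) (htop : Tendsto (fun τ => ‖Ξ τ‖) atTop atTop)
    (hbot : Tendsto (fun τ => ‖Ξ τ‖) atBot atTop) (x : EuclideanSpace ℝ (Fin 3)) (D : ℝ) :
    volume ({τ | ‖Ξ τ - x‖ ≤ D} ∩ {τ | 4 * U < ‖Ξ τ‖}) ≤ ENNReal.ofReal (4 * (3 + 4 * |α|) * D) := by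
  obtain ⟨s₀, hs₀⟩ := exists_norm_le hΞ hT heq hu htop hbot
  set S : Set ℝ := {τ | ‖Ξ τ - x‖ ≤ D} with hS
  set R : Set ℝ := {τ | s₀ ≤ τ ∧ 4 * U < ‖Ξ τ‖} with hR
  set L : Set ℝ := {τ | τ ≤ s₀ ∧ 4 * U < ‖Ξ τ‖} with hL
  have hc : 0 < 3 + 4 * |α| := by positivity
  -- growth on the two branches, in absolute-value form
  have hgrowR : ∀ τ₁ ∈ R, ∀ τ₂ ∈ R, (3 + 4 * |α|)⁻¹ * |τ₂ - τ₁| ≤ |‖Ξ τ₂‖ - ‖Ξ τ₁‖| := by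
    intro τ₁ hτ₁ τ₂ hτ₂
    rcases le_total τ₁ τ₂ with h | h
    · have := right_branch_growth hΞ hT heq hu htop hs₀ hτ₁ hτ₂ h
      rw [abs_of_nonneg (sub_nonneg.2 h)]
      exact le_trans this (le_abs_self _)
    · have := right_branch_growth hΞ hT heq hu htop hs₀ hτ₂ hτ₁ h
      rw [abs_of_nonpos (sub_nonpos.2 h), neg_sub]
      exact le_trans this (neg_le_abs _ |>.trans_eq' (by ring))
  have hgrowL : ∀ τ₁ ∈ L, ∀ τ₂ ∈ L, (3 + 4 * |α|)⁻¹ * |τ₂ - τ₁| ≤ |‖Ξ τ₂‖ - ‖Ξ τ₁‖| := by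
    intro τ₁ hτ₁ τ₂ hτ₂
    rcases le_total τ₁ τ₂ with h | h
    · have := left_branch_growth hΞ hT heq hu hbot hs₀ hτ₁ hτ₂ h
      rw [abs_of_nonneg (sub_nonneg.2 h)]
      exact le_trans this (neg_le_abs _ |>.trans_eq' (by ring))
    · have := left_branch_growth hΞ hT heq hu hbot hs₀ hτ₂ hτ₁ h
      rw [abs_of_nonpos (sub_nonpos.2 h), neg_sub]
      exact le_trans this (le_abs_self _)
  have hvR := volume_inter_le_of_growth hgrowR x D
  have hvL := volume_inter_le_of_growth hgrowL x D
  -- cover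
  have hcover : S ∩ {τ | 4 * U < ‖Ξ τ‖} ⊆ (S ∩ L) ∪ (S ∩ R) := by
    intro τ hτ
    rcases le_total τ s₀ with h | h
    · exact Or.inl ⟨hτ.1, h, hτ.2⟩
    · exact Or.inr ⟨hτ.1, h, hτ.2⟩
  calc volume (S ∩ {τ | 4 * U < ‖Ξ τ‖})
      ≤ volume ((S ∩ L) ∪ (S ∩ R)) := measure_mono hcover
    _ ≤ volume (S ∩ L) + volume (S ∩ R) := measure_union_le _ _
    _ ≤ ENNReal.ofReal (2 * (3 + 4 * |α|) * D) + ENNReal.ofReal (2 * (3 + 4 * |α|) * D) :=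
        add_le_add hvL hvR
    _ = ENNReal.ofReal (4 * (3 + 4 * |α|) * D) := by
        rcases le_or_gt 0 D with hD | hD
        · rw [← ENNReal.ofReal_add (by positivity) (by positivity)]; ring_nf
        · have h1 : 2 * (3 + 4 * |α|) * D ≤ 0 := by nlinarith
          have h2 : 4 * (3 + 4 * |α|) * D ≤ 0 := by nlinarith
          rw [ENNReal.ofReal_of_nonpos h1, ENNReal.ofReal_of_nonpos h2, add_zero]

/-- **General length bound.** With the same hypotheses, for every ball:
`volume {τ | ‖Ξ τ − x‖ ≤ D} ≤ volume ({τ | ‖Ξ τ − x‖ ≤ D} ∩ {τ | ‖Ξ τ‖ ≤ 4U}) + 4(3 + 4|α|)·D` —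
length-regularity of an equilibrium filament reduces to a no-coiling bound INSIDE its velocity ball.
[folklore] -/
theorem volume_ball_le_inner_add {Ξ u : ℝ → EuclideanSpace ℝ (Fin 3)} {w : ℝ → ℝ} {α U : ℝ}
    (hΞ : Differentiable ℝ Ξ) (hT : ∀ τ, ‖deriv Ξ τ‖ = 1)
    (heq : ∀ τ, u τ + (1 / 2 : ℝ) • Ξ τ - α • cross (EuclideanSpace.single (2 : Fin 3) (1 : ℝ)) (Ξ τ)
      = w τ • deriv Ξ τ)
    (hu : ∀ τ, ‖u τ‖ ≤ U) (htop : Tendsto (fun τ => ‖Ξ τ‖) atTop atTop)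
    (hbot : Tendsto (fun τ => ‖Ξ τ‖) atBot atTop) (x : EuclideanSpace ℝ (Fin 3)) (D : ℝ) :
    volume {τ | ‖Ξ τ - x‖ ≤ D} ≤
      volume ({τ | ‖Ξ τ - x‖ ≤ D} ∩ {τ | ‖Ξ τ‖ ≤ 4 * U}) + ENNReal.ofReal (4 * (3 + 4 * |α|) * D) := by
  have hcover : {τ | ‖Ξ τ - x‖ ≤ D} ⊆
      ({τ | ‖Ξ τ - x‖ ≤ D} ∩ {τ | ‖Ξ τ‖ ≤ 4 * U}) ∪ ({τ | ‖Ξ τ - x‖ ≤ D} ∩ {τ | 4 * U < ‖Ξ τ‖}) := by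
    intro τ hτ
    rcases le_or_gt ‖Ξ τ‖ (4 * U) with h | h
    · exact Or.inl ⟨hτ, h⟩
    · exact Or.inr ⟨hτ, h⟩
  calc volume {τ | ‖Ξ τ - x‖ ≤ D}
      ≤ volume (({τ | ‖Ξ τ - x‖ ≤ D} ∩ {τ | ‖Ξ τ‖ ≤ 4 * U}) ∪
          ({τ | ‖Ξ τ - x‖ ≤ D} ∩ {τ | 4 * U < ‖Ξ τ‖})) := measure_mono hcover
    _ ≤ volume ({τ | ‖Ξ τ - x‖ ≤ D} ∩ {τ | ‖Ξ τ‖ ≤ 4 * U}) +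
          volume ({τ | ‖Ξ τ - x‖ ≤ D} ∩ {τ | 4 * U < ‖Ξ τ‖}) := measure_union_le _ _
    _ ≤ _ := add_le_add le_rfl (volume_ball_outer_le hΞ hT heq hu htop hbot x D)

/-- **Far balls.** With the same hypotheses, a ball `B(x, D)` that misses the velocity ball
(`4U + D < ‖x‖`) is crossed with parameter length `≤ 4(3 + 4|α|)·D` — length-regularity OUTSIDE the velocity
ball holds for every equilibrium filament with bounded induced velocity, whatever the size of `U`. [folklore] -/
theorem volume_ball_le_of_far {Ξ u : ℝ → EuclideanSpace ℝ (Fin 3)} {w : ℝ → ℝ} {α U : ℝ}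
    (hΞ : Differentiable ℝ Ξ) (hT : ∀ τ, ‖deriv Ξ τ‖ = 1)
    (heq : ∀ τ, u τ + (1 / 2 : ℝ) • Ξ τ - α • cross (EuclideanSpace.single (2 : Fin 3) (1 : ℝ)) (Ξ τ)
      = w τ • deriv Ξ τ)
    (hu : ∀ τ, ‖u τ‖ ≤ U) (htop : Tendsto (fun τ => ‖Ξ τ‖) atTop atTop)
    (hbot : Tendsto (fun τ => ‖Ξ τ‖) atBot atTop) {x : EuclideanSpace ℝ (Fin 3)} {D : ℝ}
    (hfar : 4 * U + D < ‖x‖) :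
    volume {τ | ‖Ξ τ - x‖ ≤ D} ≤ ENNReal.ofReal (4 * (3 + 4 * |α|) * D) := by
  have hempty : {τ | ‖Ξ τ - x‖ ≤ D} ∩ {τ | ‖Ξ τ‖ ≤ 4 * U} = ∅ := by
    ext τ
    simp only [mem_inter_iff, mem_setOf_eq, mem_empty_iff_false, iff_false, not_and, not_le]
    intro hτ
    have h1 : ‖x‖ - ‖Ξ τ‖ ≤ ‖Ξ τ - x‖ := by
      rw [norm_sub_rev]; exact norm_sub_norm_le _ _
    linarith
  have h := volume_ball_le_inner_add hΞ hT heq hu htop hbot x D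
  rw [hempty, measure_empty, zero_add] at h
  exact h

/-! ## Inside the velocity ball under a curvature bound -/

/-- **The inner interval is short when the filament is slow.** If moreover `Ξ` is `C²` with
`‖Ξ″‖ ≤ κ₀` and `8Uκ₀ ≤ 1`, then any two parameters in the velocity ball are at most `16U` apart:
on the interval `{‖Ξ‖ ≤ 4U}` the function `½‖Ξ‖²` has second derivative `1 + ⟪Ξ, Ξ″⟫ ≥ ½` and first
derivative `|⟪Ξ, Ξ′⟫| ≤ 4U`. [folklore] -/
theorem inner_interval_length_le {Ξ u : ℝ → EuclideanSpace ℝ (Fin 3)} {w : ℝ → ℝ} {α U κ₀ : ℝ}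
    (hΞ2 : ContDiff ℝ 2 Ξ) (hT : ∀ τ, ‖deriv Ξ τ‖ = 1)
    (hκ : ∀ τ, ‖deriv (deriv Ξ) τ‖ ≤ κ₀) (hUκ : 8 * U * κ₀ ≤ 1)
    (heq : ∀ τ, u τ + (1 / 2 : ℝ) • Ξ τ - α • cross (EuclideanSpace.single (2 : Fin 3) (1 : ℝ)) (Ξ τ)
      = w τ • deriv Ξ τ)
    (hu : ∀ τ, ‖u τ‖ ≤ U) {s₁ s₂ : ℝ} (hs₁ : ‖Ξ s₁‖ ≤ 4 * U) (hs₂ : ‖Ξ s₂‖ ≤ 4 * U)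
    (h12 : s₁ ≤ s₂) : s₂ - s₁ ≤ 16 * U := by
  have hΞ : Differentiable ℝ Ξ := hΞ2.differentiable (by norm_num)
  have hTd : Differentiable ℝ (deriv Ξ) := hΞ2.differentiable_deriv_two
  have hU0 : 0 ≤ U := le_trans (norm_nonneg _) (hu s₁)
  have hκ0 : 0 ≤ κ₀ := le_trans (norm_nonneg _) (hκ s₁)
  -- φ = ⟪Ξ, Ξ′⟫ and its derivative 1 + ⟪Ξ, Ξ″⟫
  set φ : ℝ → ℝ := fun τ => ⟪Ξ τ, deriv Ξ τ⟫ with hφ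
  have hφd : ∀ τ, HasDerivAt φ (⟪Ξ τ, deriv (deriv Ξ) τ⟫ + 1) τ := by
    intro τ
    have h := (hΞ τ).hasDerivAt.inner ℝ (hTd τ).hasDerivAt
    have h1 : ⟪deriv Ξ τ, deriv Ξ τ⟫ = (1 : ℝ) := by
      rw [real_inner_self_eq_norm_sq, hT τ, one_pow]
    rw [h1] at h
    exact h
  have hφdiff : Differentiable ℝ φ := fun τ => (hφd τ).differentiableAt
  -- on [s₁, s₂] the filament stays in the velocity ball, so φ′ ≥ 1/2 there
  have hrate : ∀ τ ∈ interior (Icc s₁ s₂), (1 / 2 : ℝ) ≤ deriv φ τ := by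
    intro τ hτ
    have hτ' : τ ∈ Icc s₁ s₂ := interior_subset hτ
    have hin : ‖Ξ τ‖ ≤ 4 * U := norm_le_of_between hΞ hT heq hu hτ'.1 hτ'.2 hs₁ hs₂
    rw [(hφd τ).deriv]
    have hcs : |⟪Ξ τ, deriv (deriv Ξ) τ⟫| ≤ ‖Ξ τ‖ * ‖deriv (deriv Ξ) τ‖ := abs_real_inner_le_norm _ _
    have h1 : ‖Ξ τ‖ * ‖deriv (deriv Ξ) τ‖ ≤ 4 * U * κ₀ :=
      mul_le_mul hin (hκ τ) (norm_nonneg _) (by positivity)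
    have h2 := neg_abs_le ⟪Ξ τ, deriv (deriv Ξ) τ⟫
    linarith
  have hmv := (convex_Icc s₁ s₂).mul_sub_le_image_sub_of_le_deriv hφdiff.continuous.continuousOn
    (hφdiff.differentiableOn) hrate s₁ (left_mem_Icc.2 h12) s₂ (right_mem_Icc.2 h12) h12
  -- |φ| ≤ ‖Ξ‖ ≤ 4U at the two ends
  have hb : ∀ s, ‖Ξ s‖ ≤ 4 * U → |φ s| ≤ 4 * U := by
    intro s hs
    have := abs_real_inner_le_norm (Ξ s) (deriv Ξ s)
    rw [hT s, mul_one] at this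
    exact le_trans this hs
  have hb₁ := hb s₁ hs₁
  have hb₂ := hb s₂ hs₂
  rw [abs_le] at hb₁ hb₂
  linarith [hb₁.1, hb₂.2]

/-- **Length-regularity of slow equilibrium filaments.** A unit-speed proper `C²` filament of a relative
equilibrium with `‖Ξ″‖ ≤ κ₀`, induced velocity `‖u‖ ≤ U` along it and `8Uκ₀ ≤ 1` spends parameter length
at most `16U + 4(3 + 4|α|)·D` in any ball `B(x, D)`, `D ≥ 0`. [folklore] -/
theorem volume_ball_le_of_slow {Ξ u : ℝ → EuclideanSpace ℝ (Fin 3)} {w : ℝ → ℝ} {α U κ₀ : ℝ}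
    (hΞ2 : ContDiff ℝ 2 Ξ) (hT : ∀ τ, ‖deriv Ξ τ‖ = 1)
    (hκ : ∀ τ, ‖deriv (deriv Ξ) τ‖ ≤ κ₀) (hUκ : 8 * U * κ₀ ≤ 1)
    (heq : ∀ τ, u τ + (1 / 2 : ℝ) • Ξ τ - α • cross (EuclideanSpace.single (2 : Fin 3) (1 : ℝ)) (Ξ τ)
      = w τ • deriv Ξ τ)
    (hu : ∀ τ, ‖u τ‖ ≤ U) (htop : Tendsto (fun τ => ‖Ξ τ‖) atTop atTop)
    (hbot : Tendsto (fun τ => ‖Ξ τ‖) atBot atTop) (x : EuclideanSpace ℝ (Fin 3)) {D : ℝ} (hD : 0 ≤ D) :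
    volume {τ | ‖Ξ τ - x‖ ≤ D} ≤ ENNReal.ofReal (16 * U + 4 * (3 + 4 * |α|) * D) := by
  have hΞ : Differentiable ℝ Ξ := hΞ2.differentiable (by norm_num)
  have hU0 : 0 ≤ U := le_trans (norm_nonneg _) (hu 0)
  have hin : volume ({τ | ‖Ξ τ - x‖ ≤ D} ∩ {τ | ‖Ξ τ‖ ≤ 4 * U}) ≤ ENNReal.ofReal (16 * U) := by
    refine le_trans (measure_mono inter_subset_right) ?_
    refine le_trans (Real.volume_le_diam _) (Metric.ediam_le ?_)
    intro s₁ hs₁ s₂ hs₂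
    rw [edist_dist, Real.dist_eq]
    apply ENNReal.ofReal_le_ofReal
    rcases le_total s₁ s₂ with h | h
    · have := inner_interval_length_le hΞ2 hT hκ hUκ heq hu hs₁ hs₂ h
      rw [abs_of_nonpos (sub_nonpos.2 h)]; linarith
    · have := inner_interval_length_le hΞ2 hT hκ hUκ heq hu hs₂ hs₁ h
      rw [abs_of_nonneg (sub_nonneg.2 h)]; linarith
  calc volume {τ | ‖Ξ τ - x‖ ≤ D}
      ≤ volume ({τ | ‖Ξ τ - x‖ ≤ D} ∩ {τ | ‖Ξ τ‖ ≤ 4 * U}) + ENNReal.ofReal (4 * (3 + 4 * |α|) * D) :=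
        volume_ball_le_inner_add hΞ hT heq hu htop hbot x D
    _ ≤ ENNReal.ofReal (16 * U) + ENNReal.ofReal (4 * (3 + 4 * |α|) * D) := add_le_add hin le_rfl
    _ = ENNReal.ofReal (16 * U + 4 * (3 + 4 * |α|) * D) := by
        rw [← ENNReal.ofReal_add (by positivity) (by positivity)]

/-- **Stub currency.** In the units of `stub_lengthRegular` (`‖Ξ″‖·√Γ ≤ K`, balls of radius `D ≥ √Γ`):
a filament of a witness at circulation `Γ ≥ 1` whose induced velocity along the filament satisfies
`8·U·K ≤ √Γ` is length-regular with `C₀ = 4(3 + 4|α|) + 2/K`: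
`volume {τ | ‖Ξ τ − x‖ ≤ D} ≤ C₀·D`. [folklore] -/
theorem lengthRegular_of_slow {Ξ u : ℝ → EuclideanSpace ℝ (Fin 3)} {w : ℝ → ℝ} {α U K Γ : ℝ}
    (hK : 0 < K) (hΓ : 1 ≤ Γ) (hΞ2 : ContDiff ℝ 2 Ξ) (hT : ∀ τ, ‖deriv Ξ τ‖ = 1)
    (hκ : ∀ τ, ‖iteratedDeriv 2 Ξ τ‖ * Real.sqrt Γ ≤ K)
    (heq : ∀ τ, u τ + (1 / 2 : ℝ) • Ξ τ - α • cross (EuclideanSpace.single (2 : Fin 3) (1 : ℝ)) (Ξ τ)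
      = w τ • deriv Ξ τ)
    (hu : ∀ τ, ‖u τ‖ ≤ U) (hslow : 8 * U * K ≤ Real.sqrt Γ)
    (htop : Tendsto (fun τ => ‖Ξ τ‖) atTop atTop) (hbot : Tendsto (fun τ => ‖Ξ τ‖) atBot atTop)
    (x : EuclideanSpace ℝ (Fin 3)) {D : ℝ} (hD : Real.sqrt Γ ≤ D) :
    volume {τ | ‖Ξ τ - x‖ ≤ D} ≤ ENNReal.ofReal ((4 * (3 + 4 * |α|) + 2 / K) * D) := by
  have hsq : 0 < Real.sqrt Γ := Real.sqrt_pos.2 (by linarith)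
  have hD0 : 0 ≤ D := le_trans hsq.le hD
  have hU0 : 0 ≤ U := le_trans (norm_nonneg _) (hu 0)
  -- curvature bound κ₀ = K / √Γ
  have hκ' : ∀ τ, ‖deriv (deriv Ξ) τ‖ ≤ K / Real.sqrt Γ := by
    intro τ
    have h := hκ τ
    rw [iteratedDeriv_succ, iteratedDeriv_one] at h
    rwa [le_div_iff₀ hsq]
  have hUκ : 8 * U * (K / Real.sqrt Γ) ≤ 1 := by
    rw [show 8 * U * (K / Real.sqrt Γ) = 8 * U * K / Real.sqrt Γ by ring, div_le_one hsq]
    exact hslow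
  have h := volume_ball_le_of_slow hΞ2 hT hκ' hUκ heq hu htop hbot x hD0
  refine le_trans h (ENNReal.ofReal_le_ofReal ?_)
  -- 16 U ≤ 2 √Γ / K ≤ (2/K) D
  have h1 : 16 * U ≤ 2 / K * Real.sqrt Γ := by
    rw [div_mul_eq_mul_div, le_div_iff₀ hK]; linarith
  have h2 : 2 / K * Real.sqrt Γ ≤ 2 / K * D := mul_le_mul_of_nonneg_left hD (by positivity)
  nlinarith

end Summit.NavierStokesRegularity.NavierStokesRegularity.Theorems.SkeletonEquilibrium.LengthRegular
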